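import Literature.MathematicalPhysics.QuantumFieldTheory.Balaban1983to89.B9Thm37CutoffDivTerms
import Literature.MathematicalPhysics.QuantumFieldTheory.Balaban1983to89.Node00.OpsYRead342Cross

/-!
# `Balaban1983to89.B9Thm37TransposedCommutator` — T. Bałaban, *Propagators for lattice gauge theories in a background field*, Commun. Math.
# Phys. **99** (1985) 389–434 [Balaban1985BackgroundPropagators], Sect. C pp. 409–410: THE TRANSPOSED COMMUTATOR TERM `h_□G′_□K(h_□)` of the
# right-entry reading of the expansion (3.87)–(3.90) — the transposed (3.88) `(Σ_□h_□G′_□h_□)Δ′_a = 1 + Σ_□h_□G′_□K(h_□)`, print's `K(h)` regrouped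
# for an operator acting on its LEFT, and the (3.89)-type bound `|h_□G′_□K(h_□)| ≤ O(M⁻¹)B₀e^{−δd}` POINTWISE over the invariant class

statement-level skeleton of published theorems with citation tags; proofs where landed; nothing here is a claim about the Yang–Mills mass gap

PDF held: `paper:balaban1985-cmp99-background-propagators` (journal page = PDF page + 388); pp. 397, 408–410 read from the held text layer;
[4] = [Balaban1984PropagatorsII] pp. 224, 230–235, 247.

THE PRINT.  p. 409 (3.87) *«G′₀ = Σ_{□∈𝒟} h_□G′_□h_□»*; (3.88) *«(Δ′_ahλ)(x) = h(x)(Δ′_aλ)(x) − Σ_{b∈st(x)}(∂h)(b)(Dλ)(b) + (Δh)(x)λ(x) + …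
= h(x)(Δ′_aλ)(x) − (K(h)λ)(x)»* and *«Δ′_aG′₀ = I − Σ_□K(h_□)G′_□h_□ = I − R′»*; (3.89) *«|K(h_□)G′_□h_□| ≤ O(1)(M⁻¹ + e^{−δ₀M})B₀e^{−δ₀d(y,y′)}»*;
(3.90) *«G′ = G′₀(I − R′)⁻¹»*; p. 410: *«Theorem 3.7 implies that all the inequalities (3.42)–(3.47) hold for G′»*; Thm 3.1 (3.42) p. 397 (first and
third members); [4] p. 247 *«|∂h_□| ≤ O(1)(MLʲη)⁻¹, |Δh_□| ≤ O(1)(MLʲη)⁻²»*, (2.2) p. 224, p. 235 (the two-level window), (2.44) p. 230, (2.51)–(2.52) p. 232.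

WHY THIS FILE (cell context: G-B9-LETTERS, module M5.5 FILE 5a; consumer = FILE 5b `B9Thm37TransposedCommutatorMajorant`, which discharges the `hV`∕`hKV`
slots of FILE 2 `B9Thm37GpTorusRegularEntries.eBlock_kernelFamilySInv_Gp_of_cubes`).  Print's expansion `G′ = G′₀Σ_nR′ⁿ` closes on the LEFT entries of
(3.42); the cell's reading of record for the RIGHT entry `G′∇*_U` (r06's `B9Thm37Glue.thm37_rightEntry_of_342`, FILE 2 §3) runs through the TRANSPOSED
(3.88), `G′₀Δ′_a = 1 − V`, `V = −Σ_□h_□G′_□K(h_□)`, and needs for each transposed commutator term a (3.89)-type bound in which the cube letter acts on the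
LEFT of `K(h_□)`.  This file supplies, at def-Y's genuine letters and for a cube letter `O` (= `G′_□(V)`) whose (3.42)₁,₃ entries over the invariant class
are DISPLAYED (`h342₀`, `h342₂` — the READ shapes of `B9CubeLettersInvReadDict` §3):
* §1 the transposed (3.88) as a ring identity (`eq388T_sum`, mirror of `B9Thm37Sum.eq388_sum`) and at the partition of record (`eq388T_hT`: under the
  RIGHT local-inverse property `h_□G_□Δ′_ah_□ = h_□²` — the content of M5.1∕M5.2, displayed — `(Σ_□h_□G_□h_□)·Δ′_a(U) = 1 + Σ_□h_□G_□K(h_□)(U)`);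
* §1 print's `K(h)` REGROUPED FOR A LEFT FACTOR: per direction `(∂⁺_μh)·R(U_μ)Λ(·+e_μ) + (∂⁻̃_μh)·R(U_μ)⁻¹Λ(·−e_μ) = ∇_{V,μ}((∂⁻_μh)Λ) − (∂⁻_μh)·∇*_{V,μ}Λ`
  with `(∂⁻_μh)(w) = h(w) − h(w−e_μ)` (`commTerm_eq`, `KhY_apply_transposed`; p38's `KhY_apply` is the form for a RIGHT factor);
* §2 a generic INPUT-SIDE BLOCK SPLIT ([4] (2.51)–(2.52)): a function dominated by a profile living within one bond of `Δ(βy′)` is the sum of at most `m_N`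
  block pieces, each a member of a class on which a displayed entry of `O` applies (`norm_apply_le_of_split`; FILE 4b's argument made reusable);
* §3 sizes and windows: the per-direction second difference of `h_□` (`abs_hTY_second_diff_le`, [4] p. 247), the block of the averaging stencil, the LOWER
  half of the two-level window of `QT □` (`lvl_ge_of_mem_QT`; the upper half is `B6CubeCoeffSizesV1.level_le_of_mem_QT`), the levels on p38's stencil;
* §4 the four pieces of `O(K(h_□)Λ)(z)` bounded from (3.42)₁,₃ of `O`: `O∇_{V,μ}((∂⁻h)Λ)` (def-Y's transport `∇_μ = −∇*_μT_μ`, `OpsYRead342Cross.cdS_eq_neg_cdsS_transport`; split, (3.42)₃), `O∇*_{V,μ}((∂⁻h)Λ)`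
  ((3.42)₃ directly), the Leibniz remainder with the second difference of `h_□` (split, (3.42)₁), the averaging line (same block, (3.42)₁ with the level
  factor of the averaging weight);
* §5 ★★ `norm_hTY_O_KhY_apply_le`: `‖h_□(z)·O(K(h_□)Λ)(z)‖ ≤ θ_T·e^{−δd(y,y′)}·|f|`, `θ_T = B₀[(d+1)((1 + m_Ne^{δ})·(5∕8)C1F∕M_h + m_Ne^{δ}·(5∕8)²C2F∕M_h²) +
  L⁴·sLipT∕(L·M_h)]` — print's `O(1)M⁻¹B₀` with the `j`-uniform bookkeeping `ℓ(y)∕η = L^{lev z} ≤ L^{j+1}` near `supp h_□` and the window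
  `j − 1 ≤ lvl ≤ j + 1` of `QT □` — and the INPUT VANISHING `KhY_hTY_apply_eq_zero_of_far`: `K(h_□)Λ ≡ 0` unless `lvl(y′) ≤ j + 3`.
Nothing of (3.42) for the cube letter, of the sizes of `h_□`, of the neighbourhood count `m_N` or of Theorem 3.7 is asserted: displayed or cited by name.

WHAT IS PROVED (all `theorem`s, no `sorry`).  §1 `eq388T_sum`, `eq388T_hT`, `eq388T_hT'`, `commTerm_eq`, `KhY_apply_transposed`;
§2 `norm_apply_le_of_split`; §3 `abs_hTY_second_diff_le`, `blkOf_eq_of_avgCoeffY_ne_zero`, `lvl_ge_of_mem_QT`, `levY_le_of_mem_stencilY`, `norm_R_avgTr_le`;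
§4 `norm_O_cdS_cutMul_le`, `norm_O_cdsS_cutMul_le`, `norm_O_rem2_le`, `norm_O_avg_le`; §5 `KhY_hTY_apply_eq_zero_of_far`, ★★ `norm_hTY_O_KhY_apply_le`.
-/

noncomputable section

namespace Literature.MathematicalPhysics.QuantumFieldTheory.Balaban1983to89.B9Thm37TransposedCommutator

open Node00
open B9Thm37CubeCoverCommutators
open B9Thm37CubeCoverCommutatorSizes
open B9Thm37CubeCoverCommutatorSizesGrad
open B9Thm37CommutatorBound389 (norm_cutMulY_le_of_le lev_le_succ_of_touch lev_le_succ_of_touch' torusSupNorm_sub_shiftY_le_one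
  dist_blkOf_le_one_of_touch geo9K_dist_eq geo9K_len_eq levY_eq_lvl_of_blkOf_eq blkOf_fst_fst)
open B9Thm37CutoffGradTerms (mem_QT_and_lev_of_near torusSupNorm_sub_self_le_one len_eq_pow_mul_eta)
open B9Thm37CutoffDivTerms (cutMulY_cdsS_eq norm_R_inv_le)
open B6KLevelCensusIndexV1 (KIdx)
open B6Ineq2142KLevelV1 (β lvl beta_level)
open B4TorusKernel.MultiPeriod (torusSupNorm)
open B4Reflection242 (blk)
open B6MultiLevelBoxOperator (bigSide bigSide_eq one_le_bigSide)
open B6MultiLevelTorusOperator (tshift unitVec tshift_symm_apply one_le_of_mem)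
open B6Geom246MultiLevelBox (bset blkOf blkOf_eq_of_blk_i_eq)
open B6Geom246MultiLevelTorus (bondT connectedT)
open B6Cover236MultiLevelBlocks (cubes window)
open B6Partition118KLevelTorus (hT abs_hT_le_one)
open B6Partition118KLevelTorusCentral (QT Dch)
open B6Partition118KLevelFineSizes (C1F C1F_nonneg)
open B6Partition118KLevelFineSecond (C2F C2F_nonneg)
open B6Partition118KLevelTorusBinders (sLipT sLipT_nonneg abs_hT_second_diff_le)
open B6RandomWalk (HasMajorant hasMajorant_mono)
open B9Thm34Ext (toB6)
open B9GeoNormsKLevelV1 (geo9K geo9K_supNorm_nonneg)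
open B9GeoLemma21KLevelV1 (geo9K_dist_triangle)
open B9Ineq349SiteComposite (cdsSL cdsSL_apply etaS_pos)
open B9Eq352DivFormLetters (conj)
open B9Eq39Adjoint (R R_smul R_zero R_inv_R covD covDstar)
open B9Eq310Hermitian (norm_R_le)
open scoped Matrix

variable {𝔸 : Type} [NormedRing 𝔸] [NormedAlgebra ℂ 𝔸] [CompleteSpace 𝔸]
variable {d ℓ : ℕ} {hd : 1 ≤ d + 1} {hL : Odd (ℓ + 1) ∧ 1 < ℓ + 1} {b₀ b₁ : ℝ}
variable {ι : Type} [Fintype ι]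
variable (i : KIdx d ℓ hd hL b₀ b₁) (b : Module.Basis ι ℝ 𝔸)

/-! ## §1 The transposed (3.88) and print's `K(h)` regrouped for a left factor -/

section Algebra

/-- **THE TRANSPOSED (3.87)–(3.88) AS ALGEBRA**: in any ring, from `Δ·H_□ = H_□·Δ − K_□` ((3.88)), the RIGHT local-inverse property
`H_□G_□Δ·H_□ = H_□²` and `Σ_□H_□² = 1` (p. 408 «Σ_{□∈𝒟}h²_□ = 1»): `(Σ_□H_□G_□H_□)·Δ = 1 + Σ_□H_□G_□K_□` — the mirror image of `B9Thm37Sum.eq388_sum`.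
[cite: Balaban1985BackgroundPropagators, (3.87)–(3.88) p.409] -/
theorem eq388T_sum {A : Type*} [Ring A] {κ : Type} [Fintype κ] (Δ : A) (Hm Gl Kh : κ → A)
    (h388 : ∀ k, Δ * Hm k = Hm k * Δ - Kh k) (hlocT : ∀ k, Hm k * Gl k * Δ * Hm k = Hm k * Hm k)
    (hpu : ∑ k, Hm k * Hm k = 1) :
    (∑ k, Hm k * Gl k * Hm k) * Δ = 1 + ∑ k, Hm k * Gl k * Kh k := by
  rw [Finset.sum_mul]
  have hterm : ∀ k, Hm k * Gl k * Hm k * Δ = Hm k * Hm k + Hm k * Gl k * Kh k := fun k => by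
    have e : Hm k * Δ = Δ * Hm k + Kh k := by rw [h388 k, sub_add_cancel]
    calc Hm k * Gl k * Hm k * Δ = Hm k * Gl k * (Hm k * Δ) := by simp only [mul_assoc]
      _ = Hm k * Gl k * (Δ * Hm k + Kh k) := by rw [e]
      _ = Hm k * Gl k * Δ * Hm k + Hm k * Gl k * Kh k := by rw [mul_add]; simp only [mul_assoc]
      _ = Hm k * Hm k + Hm k * Gl k * Kh k := by rw [hlocT k]
  simp_rw [hterm]
  rw [Finset.sum_add_distrib, hpu]

/-- ★ **THE TRANSPOSED (3.88) AT THE PARTITION OF RECORD**: for any family of cube operators `G_□` with the RIGHT local-inverse property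
`h_□∘G_□∘Δ′_a(U)∘h_□ = h_□²` (print: `G′_□` is the propagator of the sequence `{Ω_n(□)}`, `Ω₀(□) ⊃ □̃ ⊃ supp h_□`, p. 408 — a HYPOTHESIS here, the
content of modules M5.1∕M5.2), `(Σ_□h_□G_□h_□)·Δ′_a(U) = 1 + Σ_□h_□G_□K(h_□)(U)` in `End_ℂ(SiteY i → 𝔸)`.
[cite: Balaban1985BackgroundPropagators, (3.87)–(3.88) p.409, p.408 («Σ h²_□ = 1»)] -/
theorem eq388T_hT (par : SiteParY 𝔸 i) (U : CfgY 𝔸 i) (Gl : ↥(cubes i.D.toDomains) → Module.End ℂ (SiteY i → 𝔸))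
    (hlocT : ∀ c, cutMulY (hTY i c) * Gl c * deltaPrimeAY i par U * cutMulY (hTY i c) = cutMulY (hTY i c) * cutMulY (hTY i c)) :
    (∑ c, cutMulY (hTY i c) * Gl c * cutMulY (hTY i c)) * deltaPrimeAY i par U
      = 1 + ∑ c, cutMulY (hTY i c) * Gl c * KhY i par (hTY i c) U :=
  eq388T_sum (deltaPrimeAY i par U) (fun c => cutMulY (hTY i c)) Gl (fun c => KhY i par (hTY i c) U)
    (fun c => deltaPrimeAY_mul_cutMulY i par (hTY i c) U) hlocT (sum_cutMulY_hT_mul_self i)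

/-- the same identity in the `1 − Σ_□V_□` shape of FILE 2's `h388T`, `V_□ = −h_□G_□K(h_□)(U)`. [cite: Balaban1985BackgroundPropagators, (3.87)–(3.88) p.409] -/
theorem eq388T_hT' (par : SiteParY 𝔸 i) (U : CfgY 𝔸 i) (Gl : ↥(cubes i.D.toDomains) → Module.End ℂ (SiteY i → 𝔸))
    (hlocT : ∀ c, cutMulY (hTY i c) * Gl c * deltaPrimeAY i par U * cutMulY (hTY i c) = cutMulY (hTY i c) * cutMulY (hTY i c)) :
    (∑ c, cutMulY (hTY i c) * Gl c * cutMulY (hTY i c)) * deltaPrimeAY i par U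
      = 1 - ∑ c, -(cutMulY (hTY i c) * Gl c * KhY i par (hTY i c) U) := by
  rw [eq388T_hT i par U Gl hlocT, Finset.sum_neg_distrib, sub_neg_eq_add]

variable (V : CfgY 𝔸 i)

/-- **ONE DIRECTION OF `K_Δ(h)` REGROUPED FOR A LEFT FACTOR**: with `g = ∂⁻_μh`, `g(u) = h(u) − h(u−e_μ)`:
`(h(w+e_μ) − h(w))·R(U_μ(w))Λ(w+e_μ) + (h(w−e_μ) − h(w))·R(U_μ(w−e_μ))⁻¹Λ(w−e_μ) = ∇_{V,μ}(gΛ)(w) − g(w)·∇*_{V,μ}Λ(w)` (print's first line of (3.88)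
`−Σ_b(∂h)(b)(Dλ)(b) + (Δh)λ`, the second differences cancelling between the two members).
[cite: Balaban1985BackgroundPropagators, (3.88) p.409 (first line), (3.3) p.390, (3.8) p.392] -/
theorem commTerm_eq (μ : Fin (d + 1)) (h : SiteY i → ℝ) (g : SiteY i → ℝ) (hg : ∀ u, g u = h u - h ((shiftY i μ).symm u))
    (Λ : SiteY i → 𝔸) (w : SiteY i) :
    (((h (shiftY i μ w) - h w : ℝ)) : ℂ) • R (UboxY i V μ w) (Λ (shiftY i μ w))
        + (((h ((shiftY i μ).symm w) - h w : ℝ)) : ℂ) • R (UboxY i V μ ((shiftY i μ).symm w))⁻¹ (Λ ((shiftY i μ).symm w))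
      = cdS i V μ (cutMulY g Λ) w - cutMulY g (cdsS i V μ Λ) w := by
  have e1 : ∀ Ψ : SiteY i → 𝔸, cdS i V μ Ψ w = R (UboxY i V μ w) (Ψ (shiftY i μ w)) - Ψ w := fun Ψ => rfl
  have e2 : ∀ Ψ : SiteY i → 𝔸,
      cdsS i V μ Ψ w = R (UboxY i V μ ((shiftY i μ).symm w))⁻¹ (Ψ ((shiftY i μ).symm w)) - Ψ w := fun Ψ => rfl
  simp only [e1, e2, cutMulY_apply, hg, Equiv.symm_apply_apply]
  rw [R_smul]
  simp only [Complex.ofReal_sub, sub_smul, smul_sub]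
  abel

/-- ★ **PRINT'S `K(h)(U)` REGROUPED FOR AN OPERATOR ACTING ON ITS LEFT**:
`(K(h)Λ)(w) = Σ_μ [∇_{V,μ}((∂⁻_μh)Λ)(w) − (∂⁻_μh)(w)·∇*_{V,μ}Λ(w)] + Σ_{w′} avgCoeffY(w,w′)(h w − h w′)·R(avgTr(w,w′))Λ(w′)` (p38's `KhY_apply` with each
direction rewritten by `commTerm_eq`). [cite: Balaban1985BackgroundPropagators, (3.88) p.409] -/
theorem KhY_apply_transposed (par : SiteParY 𝔸 i) (h : SiteY i → ℝ) (g : Fin (d + 1) → SiteY i → ℝ)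
    (hg : ∀ μ u, g μ u = h u - h ((shiftY i μ).symm u)) (Λ : SiteY i → 𝔸) (w : SiteY i) :
    KhY i par h V Λ w
      = (∑ μ : Fin (d + 1), (cdS i V μ (cutMulY (g μ) Λ) w - cutMulY (g μ) (cdsS i V μ Λ) w))
        + ∑ w', (((avgCoeffY i w w' * (h w - h w') : ℝ)) : ℂ) • R (avgTrY i par V w w') (Λ w') := by
  rw [KhY_apply]
  congr 1
  exact Finset.sum_congr rfl fun μ _ => commTerm_eq i V μ h (g μ) (hg μ) Λ w

end Algebra

/-! ## §2 The input-side block split ([4] (2.51)–(2.52)) for a function living within one bond of `Δ(βy′)` -/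

section Split

variable {δ : ℝ}

omit [CompleteSpace 𝔸] in
/-- ★ **THE INPUT-SIDE BLOCK SPLIT**: let `Φ` be a ℂ-linear operator whose value at `z` on the class of every profile `G` supported in a block `Δ(βa)` is
bounded by `K·e^{−δd(y,a)}·|G|` (a displayed entry of the cube letter), `0 ≤ δ`, and let `Ψ` be dominated by a profile `F ≥ 0` with `F ≤ C_f` which lives
within one bond of `Δ(βy′)` (`F(w) ≠ 0 ⟹ d(Δ(w), βy′) ≤ 1`).  Splitting `Ψ = Σ_{a : d(a,y′) ≤ 1} 1_{Δ(βa)}Ψ` into at most `m_N` block pieces, each in the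
class of `1_{Δ(βa)}F`, gives `‖(ΦΨ)(z)‖ ≤ m_N·e^{δ}·K·e^{−δd(y,y′)}·C_f`. [cite: Balaban1984PropagatorsII, (2.51)–(2.52) p.232 («λ = Σ_{y′}Δ(y′)λ»), (2.61) p.234; Balaban1985BackgroundPropagators, (3.42) p.397] -/
theorem norm_apply_le_of_split (hδ : 0 ≤ δ) (ιB : BlkY i → IBondY i) (hι : ∀ s, β i.hN i.D i.hk (ιB s) = s)
    (Φ : (SiteY i → 𝔸) →ₗ[ℂ] (SiteY i → 𝔸)) {K : ℝ} (hK : 0 ≤ K) (y y' : IBondY i) (z : SiteY i)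
    (hΦ : ∀ (G : SiteY i → ℝ) (a : IBondY i), (geo9K i).suppIn (Sum.inl G) a →
      ∀ Ψ' : SiteY i → 𝔸, (∀ w, ‖Ψ' w‖ ≤ |G w|) → ‖Φ Ψ' z‖ ≤ K * Real.exp (-(δ * (geo9K i).dist y a)) * (geo9K i).supNorm (Sum.inl G))
    (T : IBondY i → Finset (IBondY i)) (hT : ∀ a y' : IBondY i, (geo9K i).dist a y' ≤ 1 → a ∈ T y')
    {mN : ℕ} (hnbr : ∀ y' : IBondY i, (T y').card ≤ mN)
    (Ψ : SiteY i → 𝔸) (F : SiteY i → ℝ) (hF0 : ∀ w, 0 ≤ F w) (hΨF : ∀ w, ‖Ψ w‖ ≤ F w)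
    (hFnear : ∀ w, F w ≠ 0 → (geo9K i).dist (ιB (blkOf i.D.toDomains w)) y' ≤ 1)
    {Cf : ℝ} (hCf : 0 ≤ Cf) (hFle : ∀ w, F w ≤ Cf) :
    ‖Φ Ψ z‖ ≤ (mN : ℝ) * Real.exp δ * K * Real.exp (-(δ * (geo9K i).dist y y')) * Cf := by
  classical
  set Ψp : IBondY i → SiteY i → 𝔸 := fun a w => if ιB (blkOf i.D.toDomains w) = a then Ψ w else 0 with hΨp
  set Fp : IBondY i → SiteY i → ℝ := fun a w => if ιB (blkOf i.D.toDomains w) = a then F w else 0 with hFp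
  -- where `Ψ ≠ 0` the block is within `1` of `βy′`
  have hnear : ∀ w, Ψ w ≠ 0 → (geo9K i).dist (ιB (blkOf i.D.toDomains w)) y' ≤ 1 := fun w hw =>
    hFnear w fun h0 => hw (norm_le_zero_iff.1 ((hΨF w).trans (le_of_eq h0)))
  -- `Ψ` is the sum of its pieces over `T y′`
  have hsplit : Ψ = ∑ a ∈ T y', Ψp a := by
    funext w
    rw [Finset.sum_apply]
    show Ψ w = ∑ a ∈ T y', (if ιB (blkOf i.D.toDomains w) = a then Ψ w else 0)
    by_cases hw : Ψ w = 0
    · rw [hw]; symm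
      exact Finset.sum_eq_zero fun a _ => ite_self 0
    · rw [Finset.sum_ite_eq, if_pos (hT _ _ (hnear w hw))]
  have hsum : Φ Ψ z = ∑ a ∈ T y', Φ (Ψp a) z := by rw [hsplit, map_sum, Finset.sum_apply]
  -- each piece
  have hpiece : ∀ a ∈ T y', ‖Φ (Ψp a) z‖ ≤ Real.exp δ * K * Real.exp (-(δ * (geo9K i).dist y y')) * Cf := by
    intro a _
    by_cases ha : (geo9K i).dist a y' ≤ 1
    · have hcls : ∀ w, ‖Ψp a w‖ ≤ |Fp a w| := fun w => by
        show ‖(if ιB (blkOf i.D.toDomains w) = a then Ψ w else 0)‖ ≤ |(if ιB (blkOf i.D.toDomains w) = a then F w else 0)|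
        split_ifs
        · exact (hΨF w).trans (le_abs_self _)
        · rw [norm_zero, abs_zero]
      have hsa : (geo9K i).suppIn (Sum.inl (Fp a)) a := by
        intro w hw
        have hwa : ιB (blkOf i.D.toDomains w) = a := by
          by_contra hne
          exact hw (show (if ιB (blkOf i.D.toDomains w) = a then F w else 0) = 0 by rw [if_neg hne])
        show blkOf i.D.toDomains w = β i.hN i.D i.hk a
        rw [← hwa, hι]
      have hsup : (geo9K i).supNorm (Sum.inl (Fp a)) ≤ Cf := by
        refine Real.iSup_le (fun w => ?_) hCf
        show |(if ιB (blkOf i.D.toDomains w) = a then F w else 0)| ≤ Cf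
        split_ifs
        · rw [abs_of_nonneg (hF0 w)]; exact hFle w
        · rw [abs_zero]; exact hCf
      have h1 := hΦ (Fp a) a hsa (Ψp a) hcls
      have hexp : Real.exp (-(δ * (geo9K i).dist y a)) ≤ Real.exp δ * Real.exp (-(δ * (geo9K i).dist y y')) := by
        rw [← Real.exp_add]
        refine Real.exp_le_exp.2 ?_
        have htri := geo9K_dist_triangle i y a y'
        have h2 : δ * (geo9K i).dist y y' ≤ δ * ((geo9K i).dist y a + 1) := mul_le_mul_of_nonneg_left (htri.trans (by linarith)) hδ
        linarith
      calc ‖Φ (Ψp a) z‖ ≤ K * Real.exp (-(δ * (geo9K i).dist y a)) * (geo9K i).supNorm (Sum.inl (Fp a)) := h1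
        _ ≤ K * (Real.exp δ * Real.exp (-(δ * (geo9K i).dist y y'))) * Cf :=
          mul_le_mul (mul_le_mul_of_nonneg_left hexp hK) hsup (geo9K_supNorm_nonneg i _) (by positivity)
        _ = _ := by ring
    · have h0 : Ψp a = 0 := by
        funext w
        show (if ιB (blkOf i.D.toDomains w) = a then Ψ w else 0) = 0
        split_ifs with hwa
        · by_contra hne
          have h1 := hnear w hne
          rw [hwa] at h1
          exact ha h1
        · rfl
      rw [h0, map_zero, Pi.zero_apply, norm_zero]; positivity
  have hP0 : 0 ≤ Real.exp δ * K * Real.exp (-(δ * (geo9K i).dist y y')) * Cf := by positivity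
  rw [hsum]
  calc ‖∑ a ∈ T y', Φ (Ψp a) z‖ ≤ ∑ a ∈ T y', ‖Φ (Ψp a) z‖ := norm_sum_le _ _
    _ ≤ ∑ a ∈ T y', Real.exp δ * K * Real.exp (-(δ * (geo9K i).dist y y')) * Cf := Finset.sum_le_sum hpiece
    _ = ((T y').card : ℝ) * (Real.exp δ * K * Real.exp (-(δ * (geo9K i).dist y y')) * Cf) := by rw [Finset.sum_const, nsmul_eq_mul]
    _ ≤ (mN : ℝ) * (Real.exp δ * K * Real.exp (-(δ * (geo9K i).dist y y')) * Cf) :=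
        mul_le_mul_of_nonneg_right (Nat.cast_le.2 (hnbr y')) hP0
    _ = _ := by ring

end Split

/-! ## §3 Sizes and windows: the second difference of `h_□`, the averaging block, the window of `QT □`, the levels on the stencil -/

section Sizes

/-- **THE PER-DIRECTION SECOND DIFFERENCE OF `h_□`**: `|h_□(z+e_μ) − 2h_□(z) + h_□(z−e_μ)| ≤ C2F∕(8∕5·S_j)²` (print: `|Δh_□| ≤ O(1)(MLʲη)⁻²`; r03's
`abs_hT_second_diff_le` read on def-Y's carrier). [cite: Balaban1984PropagatorsII, p.247 («|Δh_□| ≤ O(1)(MLʲη)⁻²»); Balaban1985BackgroundPropagators, (3.88) p.409] -/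
theorem abs_hTY_second_diff_le (c : ↥(cubes i.D.toDomains)) (μ : Fin (d + 1)) (z : SiteY i) :
    |hTY i c (shiftY i μ z) - 2 * hTY i c z + hTY i c ((shiftY i μ).symm z)| ≤ C2F d ℓ / (8 / 5 * (bigSide ℓ i.Mh c.1.1 : ℝ)) ^ 2 := by
  obtain ⟨hℓ, hMh, hR, hP5⟩ := side_conditions i
  have e1 : shiftY i μ z = tshift (toKT i).NB (unitVec μ) z := rfl
  have e2 : (shiftY i μ).symm z = tshift (toKT i).NB (-unitVec μ) z := tshift_symm_apply _ _ _
  rw [e1, e2]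
  exact abs_hT_second_diff_le (D := i.D) hℓ hMh hR hP5 c μ z

omit [NormedRing 𝔸] [NormedAlgebra ℂ 𝔸] [CompleteSpace 𝔸] in
/-- the averaging coefficient only links sites of ONE block of `𝔅` (p38's step inside `abs_hTY_sub_le_of_avgCoeffY_ne_zero`).
[cite: Balaban1984PropagatorsII, (2.14) p.225; Balaban1985BackgroundPropagators, (3.88) p.409 (second line: «x′ ∈ Bʲ(y)»)] -/
theorem blkOf_eq_of_avgCoeffY_ne_zero {z w : SiteY i} (hw : avgCoeffY i z w ≠ 0) : blkOf i.D.toDomains w = blkOf i.D.toDomains z := by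
  have hblk : blk ((ℓ + 1) ^ levY i z) w.1 = blk ((ℓ + 1) ^ levY i z) z.1 := by
    by_contra hne
    exact hw (by rw [avgCoeffY, B4Reflection242.avgK, if_neg hne])
  exact blkOf_eq_of_blk_i_eq (D := i.D.toDomains) (x := z) (x' := w) (i := levY i z) le_rfl hblk

omit [NormedRing 𝔸] [NormedAlgebra ℂ 𝔸] [CompleteSpace 𝔸] in
/-- **THE LOWER HALF OF THE WINDOW OF `QT □`**: a block of `QT □` has level `≥ j − 1` (with `B6CubeCoeffSizesV1.level_le_of_mem_QT`: the levels met by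
`□⁺` are `j − 1, j, j + 1`). [cite: Balaban1984PropagatorsII, (2.2) p.224, p.235 («either □̃ ⊂ B^j(Λ_j), or it intersects B^{j+1}(Λ_{j+1}) also»)] -/
theorem lvl_ge_of_mem_QT (c : ↥(cubes i.D.toDomains)) {s : BlkY i}
    (hs : s ∈ QT i.D (B9GeoLemma21KLevelV1.one_le_Mh i) (four_le_P' i) c) : c.1.1 ≤ s.1.1 + 1 := by
  obtain ⟨_, _, hR, _⟩ := side_conditions i
  obtain ⟨y', hy', rfl⟩ := Finset.mem_image.1 hs
  rw [B6TranslateTorusV1.blkMap_fst i.D (B9GeoLemma21KLevelV1.one_le_Mh i) (fun μ => le_trans (by norm_num) (four_le_P' i μ))]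
  exact (window (Dch i.D c) (B9GeoLemma21KLevelV1.one_le_Mh i) hR hy').1

omit [NormedRing 𝔸] [NormedAlgebra ℂ 𝔸] [CompleteSpace 𝔸] in
/-- the upper half of the window (`B6CubeCoeffSizesV1.level_le_of_mem_QT`, restated in this file's binders): a block of `QT □` has level `≤ j + 1`.
[cite: Balaban1984PropagatorsII, (2.2) p.224, p.235] -/
theorem lvl_le_of_mem_QT (c : ↥(cubes i.D.toDomains)) {s : BlkY i}
    (hs : s ∈ QT i.D (B9GeoLemma21KLevelV1.one_le_Mh i) (four_le_P' i) c) : s.1.1 ≤ c.1.1 + 1 := by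
  obtain ⟨_, _, hR, _⟩ := side_conditions i
  obtain ⟨y', hy', rfl⟩ := Finset.mem_image.1 hs
  rw [B6TranslateTorusV1.blkMap_fst i.D (B9GeoLemma21KLevelV1.one_le_Mh i) (fun μ => le_trans (by norm_num) (four_le_P' i μ))]
  exact (window (Dch i.D c) (B9GeoLemma21KLevelV1.one_le_Mh i) hR hy').2

omit [NormedRing 𝔸] [NormedAlgebra ℂ 𝔸] [CompleteSpace 𝔸] in
/-- **LEVELS ON p38's STENCIL DIFFER BY AT MOST ONE**: the stencil of `w` is `w`, `w ± e_μ` (torus distance `1`, (2.2)) and the block of `w` (same level).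
[cite: Balaban1984PropagatorsII, (2.2) p.224; Balaban1985BackgroundPropagators, (3.88) p.409] -/
theorem levY_le_of_mem_stencilY {w u : SiteY i} (hu : u ∈ stencilY i w) : levY i u ≤ levY i w + 1 ∧ levY i w ≤ levY i u + 1 := by
  classical
  unfold stencilY at hu
  simp only [Finset.mem_union, Finset.mem_singleton, Finset.mem_image, Finset.mem_univ, true_and, Finset.mem_filter] at hu
  rcases hu with ((rfl | ⟨μ, rfl⟩) | ⟨μ, rfl⟩) | hne
  · exact ⟨Nat.le_succ _, Nat.le_succ _⟩
  · exact ⟨lev_le_succ_of_touch i (torusSupNorm_sub_shiftY_le_one i μ w).1, lev_le_succ_of_touch' i (torusSupNorm_sub_shiftY_le_one i μ w).1⟩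
  · exact ⟨lev_le_succ_of_touch i (torusSupNorm_sub_shiftY_le_one i μ w).2, lev_le_succ_of_touch' i (torusSupNorm_sub_shiftY_le_one i μ w).2⟩
  · have hb := blkOf_eq_of_avgCoeffY_ne_zero i hne
    have hl : levY i u = levY i w := by rw [← blkOf_fst_fst, ← blkOf_fst_fst, hb]
    rw [hl]
    exact ⟨Nat.le_succ _, Nat.le_succ _⟩

/-- at bi-contractive averaging transporters the transported value is not larger. [cite: Balaban1985BackgroundPropagators, (3.19) p.393, (3.24) p.394, bookkeeping] -/
theorem norm_R_avgTr_le (par : SiteParY 𝔸 i) (V : CfgY 𝔸 i)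
    (hTr : ∀ z w : SiteY i, ‖(avgTrY i par V z w : 𝔸)‖ ≤ 1 ∧ ‖(((avgTrY i par V z w)⁻¹ : 𝔸ˣ) : 𝔸)‖ ≤ 1)
    (z w : SiteY i) (X : 𝔸) : ‖R (avgTrY i par V z w) X‖ ≤ ‖X‖ :=
  norm_R_le (hTr z w).1 (hTr z w).2 X

end Sizes

/-! ## §4 The four pieces of `O(K(h_□)Λ)(z)` from the cube letter's (3.42)₁,₃ over the class -/

section Pieces

variable (V : CfgY 𝔸 i) (O : (SiteY i → 𝔸) →ₗ[ℂ] (SiteY i → 𝔸)) {B₀ δ : ℝ}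

/-- **PIECE `O∇*_{V,μ}(gΛ)` FOR A SMALL SCALAR `g`** (`|g| ≤ κ`): (3.42)₃ of `O` at the member `gΛ` of the class of `κ|f|` —
`‖O∇*_{V,μ}(gΛ)(z)‖ ≤ η⁻¹·B₀ℓ(y)e^{−δd(y,y′)}·κ|f|`. [cite: Balaban1985BackgroundPropagators, (3.42) p.397 (third member), (3.88) p.409] -/
theorem norm_O_cdsS_cutMul_le (μ : Fin (d + 1)) (hB₀ : 0 ≤ B₀) {κ : ℝ} (hκ : 0 ≤ κ) (g : SiteY i → ℝ) (hg : ∀ w, |g w| ≤ κ)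
    (h342₂ : ∀ (f : SiteY i → ℝ) (y y' : IBondY i), (geo9K i).suppIn (Sum.inl f) y' →
      ∀ Λ : SiteY i → 𝔸, (∀ z, ‖Λ z‖ ≤ |f z|) → ∀ (z : SiteY i) (μ : Fin (d + 1)), blkOf i.D.toDomains z = β i.hN i.D i.hk y →
        etaS i * ‖O (cdsS i V μ Λ) z‖ ≤ B₀ * (geo9K i).len y * Real.exp (-(δ * (geo9K i).dist y y')) * (geo9K i).supNorm (Sum.inl f))
    (f : SiteY i → ℝ) (y y' : IBondY i) (hs : (geo9K i).suppIn (Sum.inl f) y')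
    (Λ : SiteY i → 𝔸) (hΛ : ∀ z, ‖Λ z‖ ≤ |f z|) (z : SiteY i) (hz : blkOf i.D.toDomains z = β i.hN i.D i.hk y) :
    ‖O (cdsS i V μ (cutMulY g Λ)) z‖
      ≤ (etaS i)⁻¹ * (B₀ * (geo9K i).len y * Real.exp (-(δ * (geo9K i).dist y y')) * (κ * (geo9K i).supNorm (Sum.inl f))) := by
  have hη0 : 0 < etaS i := etaS_pos i
  have hF0 : 0 ≤ (geo9K i).supNorm (Sum.inl f) := geo9K_supNorm_nonneg i _
  have hleny : 0 ≤ (geo9K i).len y := (B6KLevelCensusIndexV1.len_pos i y).le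
  have hcls : ∀ w, ‖cutMulY g Λ w‖ ≤ abs (κ * |f w|) := fun w => by
    rw [cutMulY_apply, norm_ofReal_smul, abs_of_nonneg (mul_nonneg hκ (abs_nonneg _))]
    exact mul_le_mul (hg w) (hΛ w) (norm_nonneg _) hκ
  have hsG : (geo9K i).suppIn (Sum.inl (fun w => κ * |f w|)) y' := by
    intro w hw
    have hf : f w ≠ 0 := fun h0 => hw (show κ * |f w| = 0 by rw [h0, abs_zero, mul_zero])
    exact hs w hf
  have hsup : (geo9K i).supNorm (Sum.inl (fun w => κ * |f w|)) ≤ κ * (geo9K i).supNorm (Sum.inl f) := by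
    refine Real.iSup_le (fun w => ?_) (mul_nonneg hκ hF0)
    show abs (κ * |f w|) ≤ _
    rw [abs_of_nonneg (mul_nonneg hκ (abs_nonneg _))]
    exact mul_le_mul_of_nonneg_left (OpsYRead342.abs_le_supNorm_inl i f w) hκ
  have h1 := h342₂ (fun w => κ * |f w|) y y' hsG (cutMulY g Λ) hcls z μ hz
  rw [le_inv_mul_iff₀ hη0]
  exact h1.trans (mul_le_mul_of_nonneg_left hsup (by positivity))

/-- **PIECE `O∇_{V,μ}(gΛ)` FOR A SMALL SCALAR `g`**: by the transport `∇_μ = −∇*_μT_μ`, `T_μ(gΛ)(w) = g(w+e_μ)·R(U_μ(w))Λ(w+e_μ)` lives within one bond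
of `Δ(βy′)` and is dominated by `κ|f(·+e_μ)|` (bi-contractive bond variables); the input-side split and (3.42)₃ give
`‖O∇_{V,μ}(gΛ)(z)‖ ≤ m_N·e^{δ}·η⁻¹B₀ℓ(y)·e^{−δd(y,y′)}·κ|f|`. [cite: Balaban1985BackgroundPropagators, (3.42) p.397 (third member), (3.3) p.390, (3.8) p.392; Balaban1984PropagatorsII, (2.51)–(2.52) p.232] -/
theorem norm_O_cdS_cutMul_le (μ : Fin (d + 1)) (hB₀ : 0 ≤ B₀) (hδ : 0 ≤ δ) (ιB : BlkY i → IBondY i) (hι : ∀ s, β i.hN i.D i.hk (ιB s) = s)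
    (hV : ∀ (μ : Fin (d + 1)) (x : SiteY i), ‖(UboxY i V μ x : 𝔸)‖ ≤ 1 ∧ ‖(((UboxY i V μ x)⁻¹ : 𝔸ˣ) : 𝔸)‖ ≤ 1)
    {κ : ℝ} (hκ : 0 ≤ κ) (g : SiteY i → ℝ) (hg : ∀ w, |g w| ≤ κ)
    (h342₂ : ∀ (f : SiteY i → ℝ) (y y' : IBondY i), (geo9K i).suppIn (Sum.inl f) y' →
      ∀ Λ : SiteY i → 𝔸, (∀ z, ‖Λ z‖ ≤ |f z|) → ∀ (z : SiteY i) (μ : Fin (d + 1)), blkOf i.D.toDomains z = β i.hN i.D i.hk y →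
        etaS i * ‖O (cdsS i V μ Λ) z‖ ≤ B₀ * (geo9K i).len y * Real.exp (-(δ * (geo9K i).dist y y')) * (geo9K i).supNorm (Sum.inl f))
    (T : IBondY i → Finset (IBondY i)) (hT : ∀ a y' : IBondY i, (geo9K i).dist a y' ≤ 1 → a ∈ T y')
    {mN : ℕ} (hnbr : ∀ y' : IBondY i, (T y').card ≤ mN)
    (f : SiteY i → ℝ) (y y' : IBondY i) (hs : (geo9K i).suppIn (Sum.inl f) y')
    (Λ : SiteY i → 𝔸) (hΛ : ∀ z, ‖Λ z‖ ≤ |f z|) (z : SiteY i) (hz : blkOf i.D.toDomains z = β i.hN i.D i.hk y) :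
    ‖O (cdS i V μ (cutMulY g Λ)) z‖
      ≤ (mN : ℝ) * Real.exp δ * ((etaS i)⁻¹ * (B₀ * (geo9K i).len y)) * Real.exp (-(δ * (geo9K i).dist y y'))
          * (κ * (geo9K i).supNorm (Sum.inl f)) := by
  have hη0 : 0 < etaS i := etaS_pos i
  have hF0 : 0 ≤ (geo9K i).supNorm (Sum.inl f) := geo9K_supNorm_nonneg i _
  have hleny : 0 ≤ (geo9K i).len y := (B6KLevelCensusIndexV1.len_pos i y).le
  have hK : 0 ≤ (etaS i)⁻¹ * (B₀ * (geo9K i).len y) := by positivity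
  -- the operator `O∘∇*_{V,μ}` on the class of a profile supported in one block: (3.42)₃
  have hΦ : ∀ (G : SiteY i → ℝ) (a : IBondY i), (geo9K i).suppIn (Sum.inl G) a →
      ∀ Ψ' : SiteY i → 𝔸, (∀ w, ‖Ψ' w‖ ≤ |G w|) → ‖(O ∘ₗ cdsSL i V μ) Ψ' z‖
        ≤ (etaS i)⁻¹ * (B₀ * (geo9K i).len y) * Real.exp (-(δ * (geo9K i).dist y a)) * (geo9K i).supNorm (Sum.inl G) := by
    intro G a hsa Ψ' hΨ'
    have h1 := h342₂ G y a hsa Ψ' hΨ' z μ hz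
    have h2 : ‖O (cdsS i V μ Ψ') z‖
        ≤ (etaS i)⁻¹ * (B₀ * (geo9K i).len y * Real.exp (-(δ * (geo9K i).dist y a)) * (geo9K i).supNorm (Sum.inl G)) := by
      rw [le_inv_mul_iff₀ hη0]; exact h1
    calc ‖(O ∘ₗ cdsSL i V μ) Ψ' z‖ = ‖O (cdsS i V μ Ψ') z‖ := rfl
      _ ≤ _ := h2
      _ = _ := by ring
  -- the transported member and its profile
  have hΨF : ∀ w, ‖R (UboxY i V μ w) (cutMulY g Λ (shiftY i μ w))‖ ≤ κ * |f (shiftY i μ w)| := fun w => by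
    refine (norm_R_le (hV μ w).1 (hV μ w).2 _).trans ?_
    rw [cutMulY_apply, norm_ofReal_smul]
    exact mul_le_mul (hg _) (hΛ _) (norm_nonneg _) hκ
  have hFnear : ∀ w, κ * |f (shiftY i μ w)| ≠ 0 → (geo9K i).dist (ιB (blkOf i.D.toDomains w)) y' ≤ 1 := fun w hw => by
    have hf : f (shiftY i μ w) ≠ 0 := fun h0 => hw (by rw [h0, abs_zero, mul_zero])
    have hblk : blkOf i.D.toDomains (shiftY i μ w) = β i.hN i.D i.hk y' := hs _ hf
    rw [geo9K_dist_eq, hι, ← hblk]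
    exact_mod_cast dist_blkOf_le_one_of_touch i (torusSupNorm_sub_shiftY_le_one i μ w).1
  have h := norm_apply_le_of_split i hδ ιB hι (O ∘ₗ cdsSL i V μ) hK y y' z hΦ T hT hnbr
    (fun w => R (UboxY i V μ w) (cutMulY g Λ (shiftY i μ w))) (fun w => κ * |f (shiftY i μ w)|)
    (fun w => mul_nonneg hκ (abs_nonneg _)) hΨF hFnear (mul_nonneg hκ hF0)
    (fun w => mul_le_mul_of_nonneg_left (OpsYRead342.abs_le_supNorm_inl i f _) hκ)
  rw [OpsYRead342Cross.cdS_eq_neg_cdsS_transport i V μ, map_neg, Pi.neg_apply, norm_neg]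
  exact h

/-- **PIECE: THE LEIBNIZ REMAINDER WITH THE SECOND DIFFERENCE OF THE CUT-OFF** — `C(w) = (g(w) − g(w−e_μ))·R(U_μ(w−e_μ))⁻¹Λ(w−e_μ)`,
`|g(w) − g(w−e_μ)| ≤ κ₂`: the input-side split and (3.42)₁ give `‖(OC)(z)‖ ≤ m_N·e^{δ}·η⁻²B₀ℓ(y)²·e^{−δd(y,y′)}·κ₂|f|`.
[cite: Balaban1985BackgroundPropagators, (3.42) p.397 (first member), (3.100) p.413; Balaban1984PropagatorsII, p.247, (2.51)–(2.52) p.232] -/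
theorem norm_O_rem2_le (μ : Fin (d + 1)) (hB₀ : 0 ≤ B₀) (hδ : 0 ≤ δ) (ιB : BlkY i → IBondY i) (hι : ∀ s, β i.hN i.D i.hk (ιB s) = s)
    (hV : ∀ (μ : Fin (d + 1)) (x : SiteY i), ‖(UboxY i V μ x : 𝔸)‖ ≤ 1 ∧ ‖(((UboxY i V μ x)⁻¹ : 𝔸ˣ) : 𝔸)‖ ≤ 1)
    {κ₂ : ℝ} (hκ₂ : 0 ≤ κ₂) (g : SiteY i → ℝ) (hg2 : ∀ w, |g w - g ((shiftY i μ).symm w)| ≤ κ₂)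
    (h342₀ : ∀ (f : SiteY i → ℝ) (y y' : IBondY i), (geo9K i).suppIn (Sum.inl f) y' →
      ∀ Λ : SiteY i → 𝔸, (∀ z, ‖Λ z‖ ≤ |f z|) → ∀ z : SiteY i, blkOf i.D.toDomains z = β i.hN i.D i.hk y →
        etaS i ^ 2 * ‖O Λ z‖ ≤ B₀ * (geo9K i).len y ^ 2 * Real.exp (-(δ * (geo9K i).dist y y')) * (geo9K i).supNorm (Sum.inl f))
    (T : IBondY i → Finset (IBondY i)) (hT : ∀ a y' : IBondY i, (geo9K i).dist a y' ≤ 1 → a ∈ T y')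
    {mN : ℕ} (hnbr : ∀ y' : IBondY i, (T y').card ≤ mN)
    (f : SiteY i → ℝ) (y y' : IBondY i) (hs : (geo9K i).suppIn (Sum.inl f) y')
    (Λ : SiteY i → 𝔸) (hΛ : ∀ z, ‖Λ z‖ ≤ |f z|)
    (C : SiteY i → 𝔸) (hC : ∀ w, C w = (((g w - g ((shiftY i μ).symm w) : ℝ)) : ℂ) •
      R (UboxY i V μ ((shiftY i μ).symm w))⁻¹ (Λ ((shiftY i μ).symm w)))
    (z : SiteY i) (hz : blkOf i.D.toDomains z = β i.hN i.D i.hk y) :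
    ‖O C z‖
      ≤ (mN : ℝ) * Real.exp δ * ((etaS i ^ 2)⁻¹ * (B₀ * (geo9K i).len y ^ 2)) * Real.exp (-(δ * (geo9K i).dist y y'))
          * (κ₂ * (geo9K i).supNorm (Sum.inl f)) := by
  have hη0 : 0 < etaS i := etaS_pos i
  have hF0 : 0 ≤ (geo9K i).supNorm (Sum.inl f) := geo9K_supNorm_nonneg i _
  have hK : 0 ≤ (etaS i ^ 2)⁻¹ * (B₀ * (geo9K i).len y ^ 2) := by positivity
  have hΦ : ∀ (G : SiteY i → ℝ) (a : IBondY i), (geo9K i).suppIn (Sum.inl G) a →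
      ∀ Ψ' : SiteY i → 𝔸, (∀ w, ‖Ψ' w‖ ≤ |G w|) → ‖O Ψ' z‖
        ≤ (etaS i ^ 2)⁻¹ * (B₀ * (geo9K i).len y ^ 2) * Real.exp (-(δ * (geo9K i).dist y a)) * (geo9K i).supNorm (Sum.inl G) := by
    intro G a hsa Ψ' hΨ'
    have h1 := h342₀ G y a hsa Ψ' hΨ' z hz
    have h2 : ‖O Ψ' z‖ ≤ (etaS i ^ 2)⁻¹ * (B₀ * (geo9K i).len y ^ 2 * Real.exp (-(δ * (geo9K i).dist y a)) * (geo9K i).supNorm (Sum.inl G)) := by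
      rw [le_inv_mul_iff₀ (pow_pos hη0 2)]; exact h1
    exact h2.trans (le_of_eq (by ring))
  have hΨF : ∀ w, ‖C w‖ ≤ κ₂ * |f ((shiftY i μ).symm w)| := fun w => by
    rw [hC w, norm_ofReal_smul]
    exact mul_le_mul (hg2 w) ((norm_R_inv_le i V hV μ _ _).trans (hΛ _)) (norm_nonneg _) hκ₂
  have hFnear : ∀ w, κ₂ * |f ((shiftY i μ).symm w)| ≠ 0 → (geo9K i).dist (ιB (blkOf i.D.toDomains w)) y' ≤ 1 := fun w hw => by
    have hf : f ((shiftY i μ).symm w) ≠ 0 := fun h0 => hw (by rw [h0, abs_zero, mul_zero])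
    have hblk : blkOf i.D.toDomains ((shiftY i μ).symm w) = β i.hN i.D i.hk y' := hs _ hf
    rw [geo9K_dist_eq, hι, ← hblk]
    exact_mod_cast dist_blkOf_le_one_of_touch i (torusSupNorm_sub_shiftY_le_one i μ w).2
  exact norm_apply_le_of_split i hδ ιB hι O hK y y' z hΦ T hT hnbr C (fun w => κ₂ * |f ((shiftY i μ).symm w)|)
    (fun w => mul_nonneg hκ₂ (abs_nonneg _)) hΨF hFnear (mul_nonneg hκ₂ hF0)
    (fun w => mul_le_mul_of_nonneg_left (OpsYRead342.abs_le_supNorm_inl i f _) hκ₂)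

variable (par : SiteParY 𝔸 i)

/-- **PIECE: THE AVERAGING LINE OF (3.88)** — `A(w) = Σ_{w′} avgCoeffY(w,w′)(h_□(w) − h_□(w′))·R(avgTr(w,w′))Λ(w′)` links sites of ONE block, where `h_□`
moves by at most `sLipT∕(L·M_h)`, and the averaging weight carries `(L^{lvl})⁻²`: `A` is a member of the class of the profile
`(sLipT∕(L·M_h))·Σ_{w′}|avgCoeffY(w,w′)||f(w′)|` supported in `Δ(βy′)`, so (3.42)₁ gives
`‖(OA)(z)‖ ≤ η⁻²B₀ℓ(y)²e^{−δd(y,y′)}·(sLipT∕(L·M_h))·(L^{lvl y′})⁻²·|f|`. [cite: Balaban1985BackgroundPropagators, (3.88) p.409 (second line), (3.42) p.397 (first member); Balaban1984PropagatorsII, (2.14) p.225, p.247] -/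
theorem norm_O_avg_le (c : ↥(cubes i.D.toDomains)) (hB₀ : 0 ≤ B₀)
    (hTr : ∀ z w : SiteY i, ‖(avgTrY i par V z w : 𝔸)‖ ≤ 1 ∧ ‖(((avgTrY i par V z w)⁻¹ : 𝔸ˣ) : 𝔸)‖ ≤ 1)
    (h342₀ : ∀ (f : SiteY i → ℝ) (y y' : IBondY i), (geo9K i).suppIn (Sum.inl f) y' →
      ∀ Λ : SiteY i → 𝔸, (∀ z, ‖Λ z‖ ≤ |f z|) → ∀ z : SiteY i, blkOf i.D.toDomains z = β i.hN i.D i.hk y →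
        etaS i ^ 2 * ‖O Λ z‖ ≤ B₀ * (geo9K i).len y ^ 2 * Real.exp (-(δ * (geo9K i).dist y y')) * (geo9K i).supNorm (Sum.inl f))
    (f : SiteY i → ℝ) (y y' : IBondY i) (hs : (geo9K i).suppIn (Sum.inl f) y')
    (Λ : SiteY i → 𝔸) (hΛ : ∀ z, ‖Λ z‖ ≤ |f z|)
    (A : SiteY i → 𝔸) (hA : ∀ w, A w = ∑ w', (((avgCoeffY i w w' * (hTY i c w - hTY i c w') : ℝ)) : ℂ) • R (avgTrY i par V w w') (Λ w'))
    (z : SiteY i) (hz : blkOf i.D.toDomains z = β i.hN i.D i.hk y) :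
    ‖O A z‖ ≤ (etaS i ^ 2)⁻¹ * (B₀ * (geo9K i).len y ^ 2 * Real.exp (-(δ * (geo9K i).dist y y')) *
        (sLipT d ℓ / (((ℓ : ℝ) + 1) * i.Mh) * ((((ℓ : ℝ) + 1) ^ lvl i.hN i.D i.hk y') ^ 2)⁻¹ * (geo9K i).supNorm (Sum.inl f))) := by
  classical
  obtain ⟨_, hMh2, _, _⟩ := side_conditions i
  have hη0 : 0 < etaS i := etaS_pos i
  have hM : (0 : ℝ) < i.Mh := by exact_mod_cast (lt_of_lt_of_le (by norm_num) hMh2)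
  have hF0 : 0 ≤ (geo9K i).supNorm (Sum.inl f) := geo9K_supNorm_nonneg i _
  have hCs : 0 ≤ sLipT d ℓ / (((ℓ : ℝ) + 1) * i.Mh) := div_nonneg (sLipT_nonneg d ℓ) (by positivity)
  set Cs : ℝ := sLipT d ℓ / (((ℓ : ℝ) + 1) * i.Mh) with hCsdef
  set F : SiteY i → ℝ := fun w => Cs * ∑ w', |avgCoeffY i w w'| * |f w'| with hF
  have hS0 : ∀ w, 0 ≤ ∑ w', |avgCoeffY i w w'| * |f w'| := fun w => Finset.sum_nonneg fun _ _ => mul_nonneg (abs_nonneg _) (abs_nonneg _)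
  have hF0' : ∀ w, 0 ≤ F w := fun w => mul_nonneg hCs (hS0 w)
  -- `A` is in the class of `F`
  have hcls : ∀ w, ‖A w‖ ≤ |F w| := fun w => by
    rw [hA w, abs_of_nonneg (hF0' w)]
    show _ ≤ Cs * ∑ w', |avgCoeffY i w w'| * |f w'|
    rw [Finset.mul_sum]
    refine (norm_sum_le _ _).trans (Finset.sum_le_sum fun w' _ => ?_)
    rw [norm_ofReal_smul, abs_mul]
    have hR := norm_R_avgTr_le i par V hTr w w' (Λ w')
    by_cases ha : avgCoeffY i w w' = 0
    · simp [ha]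
    · have hlip := abs_hTY_sub_le_of_avgCoeffY_ne_zero i c ha
      calc |avgCoeffY i w w'| * |hTY i c w - hTY i c w'| * ‖R (avgTrY i par V w w') (Λ w')‖
          ≤ |avgCoeffY i w w'| * Cs * |f w'| :=
            mul_le_mul (mul_le_mul_of_nonneg_left hlip (abs_nonneg _)) (hR.trans (hΛ w')) (norm_nonneg _) (by positivity)
        _ = Cs * (|avgCoeffY i w w'| * |f w'|) := by ring
  -- `F` is supported in `Δ(βy′)` (same block)
  have hsF : (geo9K i).suppIn (Sum.inl F) y' := by
    intro w hw
    have hne : ∑ w', |avgCoeffY i w w'| * |f w'| ≠ 0 := fun h0 => hw (show Cs * _ = 0 by rw [h0, mul_zero])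
    obtain ⟨w', _, hw'⟩ := Finset.exists_ne_zero_of_sum_ne_zero hne
    have ha : avgCoeffY i w w' ≠ 0 := fun h0 => hw' (by rw [h0, abs_zero, zero_mul])
    have hf : f w' ≠ 0 := fun h0 => hw' (by rw [h0, abs_zero, mul_zero])
    show blkOf i.D.toDomains w = β i.hN i.D i.hk y'
    rw [← blkOf_eq_of_avgCoeffY_ne_zero i ha]
    exact hs w' hf
  -- the size of `F`, with the level factor of the averaging weight
  have hsup : (geo9K i).supNorm (Sum.inl F) ≤ Cs * ((((ℓ : ℝ) + 1) ^ lvl i.hN i.D i.hk y') ^ 2)⁻¹ * (geo9K i).supNorm (Sum.inl f) := by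
    refine Real.iSup_le (fun w => ?_) (by positivity)
    show |F w| ≤ _
    rw [abs_of_nonneg (hF0' w)]
    by_cases hw : F w = 0
    · rw [hw]; positivity
    · have hblk : blkOf i.D.toDomains w = β i.hN i.D i.hk y' := hsF w hw
      have hlev : levY i w = lvl i.hN i.D i.hk y' := levY_eq_lvl_of_blkOf_eq i hblk
      have h1 : ∑ w', |avgCoeffY i w w'| * |f w'| ≤ (∑ w', |avgCoeffY i w w'|) * (geo9K i).supNorm (Sum.inl f) := by
        rw [Finset.sum_mul]
        exact Finset.sum_le_sum fun w' _ => mul_le_mul_of_nonneg_left (OpsYRead342.abs_le_supNorm_inl i f w') (abs_nonneg _)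
      have h2 := sum_abs_avgCoeffY_le_levFactor i w
      rw [hlev] at h2
      show Cs * ∑ w', |avgCoeffY i w w'| * |f w'| ≤ _
      calc Cs * ∑ w', |avgCoeffY i w w'| * |f w'| ≤ Cs * ((∑ w', |avgCoeffY i w w'|) * (geo9K i).supNorm (Sum.inl f)) :=
            mul_le_mul_of_nonneg_left h1 hCs
        _ ≤ Cs * (((((ℓ : ℝ) + 1) ^ lvl i.hN i.D i.hk y') ^ 2)⁻¹ * (geo9K i).supNorm (Sum.inl f)) :=
            mul_le_mul_of_nonneg_left (mul_le_mul_of_nonneg_right h2 hF0) hCs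
        _ = _ := by ring
  have h1 := h342₀ F y y' hsF A hcls z hz
  rw [le_inv_mul_iff₀ (pow_pos hη0 2)]
  exact h1.trans (mul_le_mul_of_nonneg_left hsup (by positivity))

/-- where the averaging line does not vanish identically, `h_□` is non-constant on the block `βy′`, which therefore belongs to `QT □`.
[cite: Balaban1985BackgroundPropagators, (3.88) p.409 (second line), (3.91) p.410] -/
theorem beta_mem_QT_of_avg_ne_zero (c : ↥(cubes i.D.toDomains)) (f : SiteY i → ℝ) (y' : IBondY i) (hs : (geo9K i).suppIn (Sum.inl f) y')
    (Λ : SiteY i → 𝔸) (hΛ : ∀ z, ‖Λ z‖ ≤ |f z|)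
    (A : SiteY i → 𝔸) (hA : ∀ w, A w = ∑ w', (((avgCoeffY i w w' * (hTY i c w - hTY i c w') : ℝ)) : ℂ) • R (avgTrY i par V w w') (Λ w'))
    (hne : A ≠ 0) : β i.hN i.D i.hk y' ∈ QT i.D (B9GeoLemma21KLevelV1.one_le_Mh i) (four_le_P' i) c := by
  classical
  obtain ⟨_, hMh2, hR, _⟩ := side_conditions i
  obtain ⟨w, hw⟩ := Function.ne_iff.1 hne
  rw [Pi.zero_apply, hA w] at hw
  obtain ⟨w', _, hw'⟩ := Finset.exists_ne_zero_of_sum_ne_zero hw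
  have ha : avgCoeffY i w w' * (hTY i c w - hTY i c w') ≠ 0 := fun h0 => hw' (by rw [h0, Complex.ofReal_zero, zero_smul])
  have hΛ' : Λ w' ≠ 0 := fun h0 => hw' (by rw [h0, R_zero, smul_zero])
  have hac : avgCoeffY i w w' ≠ 0 := left_ne_zero_of_mul ha
  have hhh : hTY i c w - hTY i c w' ≠ 0 := right_ne_zero_of_mul ha
  have hf : f w' ≠ 0 := fun h0 => hΛ' (norm_le_zero_iff.1 ((hΛ w').trans (by rw [h0, abs_zero])))
  have hb' : blkOf i.D.toDomains w' = β i.hN i.D i.hk y' := hs w' hf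
  have hbw : blkOf i.D.toDomains w' = blkOf i.D.toDomains w := blkOf_eq_of_avgCoeffY_ne_zero i hac
  by_cases h0 : hTY i c w = 0
  · have h0' : hTY i c w' ≠ 0 := by
      intro e; apply hhh; rw [h0, e, sub_zero]
    rw [← hb']
    exact B6Partition118KLevelTorusCentral.blkOf_mem_QT_of_hT_ne_zero (D := i.D) hMh2 hR (four_le_P' i) c h0'
  · rw [← hb', hbw]
    exact B6Partition118KLevelTorusCentral.blkOf_mem_QT_of_hT_ne_zero (D := i.D) hMh2 hR (four_le_P' i) c h0

end Pieces

/-! ## §5 Input vanishing beyond the window; ★★ the transposed (3.89): `‖h_□(z)·O(K(h_□)Λ)(z)‖ ≤ θ_T·e^{−δd(y,y′)}·|f|` -/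

section Main

variable (V : CfgY 𝔸 i) (O : (SiteY i → 𝔸) →ₗ[ℂ] (SiteY i → 𝔸)) (par : SiteParY 𝔸 i) {B₀ δ : ℝ}

/-- **INPUT VANISHING OF `K(h_□)`**: for a test function of the class of `f`, `supp f ⊂ Δ(βy′)` with `lvl(y′) > j + 3`, `K(h_□)(V)Λ ≡ 0` — `K(h_□)Λ(w)`
reads `Λ` on p38's stencil of `w` only, on which some site carries `h_□ ≠ 0` (block in `QT □`, level `≤ j + 1`) and the levels differ by at most one
per step. [cite: Balaban1985BackgroundPropagators, (3.88) p.409, (3.91) p.410; Balaban1984PropagatorsII, (2.2) p.224, p.235] -/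
theorem KhY_hTY_eq_zero_of_far (c : ↥(cubes i.D.toDomains)) {f : SiteY i → ℝ} {y' : IBondY i} (hs : (geo9K i).suppIn (Sum.inl f) y')
    (Λ : SiteY i → 𝔸) (hΛ : ∀ z, ‖Λ z‖ ≤ |f z|) (hfar : c.1.1 + 3 < lvl i.hN i.D i.hk y') : KhY i par (hTY i c) V Λ = 0 := by
  classical
  refine funext fun w => ?_
  rw [Pi.zero_apply]
  by_contra hne
  obtain ⟨u', hu', hQT⟩ := exists_mem_stencilY_blkOf_mem_QT_of_KhY_ne_zero i par c V Λ w hne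
  have hΛst : ∃ u ∈ stencilY i w, Λ u ≠ 0 := by
    by_contra h0
    push Not at h0
    apply hne
    rw [KhY_apply_congr i par (hTY i c) V w (Λ' := 0) (fun u hu => by rw [h0 u hu]; rfl), map_zero, Pi.zero_apply]
  obtain ⟨u, hu, hΛu⟩ := hΛst
  have hf : f u ≠ 0 := fun h0 => hΛu (norm_le_zero_iff.1 ((hΛ u).trans (by rw [h0, abs_zero])))
  have hbu : blkOf i.D.toDomains u = β i.hN i.D i.hk y' := hs u hf
  have hlu : levY i u = lvl i.hN i.D i.hk y' := levY_eq_lvl_of_blkOf_eq i hbu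
  have h1 := (levY_le_of_mem_stencilY i hu).1
  have h2 := (levY_le_of_mem_stencilY i hu').2
  have h3 : levY i u' ≤ c.1.1 + 1 := by
    have h := lvl_le_of_mem_QT i c hQT
    rwa [blkOf_fst_fst] at h
  omega
set_option maxHeartbeats 400000 in
/-- ★★ **THE TRANSPOSED (3.89), POINTWISE OVER THE CLASS**: for a cube letter `O` with (3.42)₁,₃ displayed over the invariant class, the cut-off `h_□` of the
partition of record, `η = |c_f|⁻¹`, `0 ≤ δ`, bi-contractive bond variables and averaging transporters, and at most `m_N` index bonds within distance
`1` of any bond: `‖h_□(z)·(O K(h_□)(V)Λ)(z)‖ ≤ θ_T·e^{−δd(y,y′)}·|f|` for `z ∈ Δ(βy)`, `‖Λ‖ ≤ |f|`, `supp f ⊂ Δ(βy′)`, with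
`θ_T = B₀·[(d+1)·((1 + m_Ne^{δ})·(5∕8)C1F∕M_h + m_Ne^{δ}·(5∕8)²C2F∕M_h²) + L⁴·sLipT∕(L·M_h)]` — print's `O(1)M⁻¹B₀`: per direction the pieces
`O∇_{V,μ}((∂⁻h_□)Λ)`, `O∇*_{V,μ}((∂⁻h_□)Λ)` ((3.42)₃, `|∂h_□|·L^{lev z} ≤ (5∕8)C1F∕M_h`) and the second-difference remainder ((3.42)₁,
`|∂²h_□|·L^{2lev z} ≤ (5∕8)²C2F∕M_h²`), plus the averaging line ((3.42)₁, the window `j − 1 ≤ lvl ≤ j + 1` of `QT □`), the factor `h_□(z) ≠ 0` forcing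
`lev z ≤ j + 1`. [cite: Balaban1985BackgroundPropagators, (3.88)–(3.89) p.409, (3.42) p.397, p.410; Balaban1984PropagatorsII, (2.44) p.230, p.247, (2.51)–(2.52) p.232, p.235] -/
theorem norm_hTY_O_KhY_apply_le (c : ↥(cubes i.D.toDomains)) (hB₀ : 0 ≤ B₀) (hδ : 0 ≤ δ) (hη : etaS i = |i.cf|⁻¹)
    (ιB : BlkY i → IBondY i) (hι : ∀ s, β i.hN i.D i.hk (ιB s) = s)
    (hV : ∀ (μ : Fin (d + 1)) (x : SiteY i), ‖(UboxY i V μ x : 𝔸)‖ ≤ 1 ∧ ‖(((UboxY i V μ x)⁻¹ : 𝔸ˣ) : 𝔸)‖ ≤ 1)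
    (hTr : ∀ z w : SiteY i, ‖(avgTrY i par V z w : 𝔸)‖ ≤ 1 ∧ ‖(((avgTrY i par V z w)⁻¹ : 𝔸ˣ) : 𝔸)‖ ≤ 1)
    (h342₀ : ∀ (f : SiteY i → ℝ) (y y' : IBondY i), (geo9K i).suppIn (Sum.inl f) y' →
      ∀ Λ : SiteY i → 𝔸, (∀ z, ‖Λ z‖ ≤ |f z|) → ∀ z : SiteY i, blkOf i.D.toDomains z = β i.hN i.D i.hk y →
        etaS i ^ 2 * ‖O Λ z‖ ≤ B₀ * (geo9K i).len y ^ 2 * Real.exp (-(δ * (geo9K i).dist y y')) * (geo9K i).supNorm (Sum.inl f))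
    (h342₂ : ∀ (f : SiteY i → ℝ) (y y' : IBondY i), (geo9K i).suppIn (Sum.inl f) y' →
      ∀ Λ : SiteY i → 𝔸, (∀ z, ‖Λ z‖ ≤ |f z|) → ∀ (z : SiteY i) (μ : Fin (d + 1)), blkOf i.D.toDomains z = β i.hN i.D i.hk y →
        etaS i * ‖O (cdsS i V μ Λ) z‖ ≤ B₀ * (geo9K i).len y * Real.exp (-(δ * (geo9K i).dist y y')) * (geo9K i).supNorm (Sum.inl f))
    (T : IBondY i → Finset (IBondY i)) (hT : ∀ a y' : IBondY i, (geo9K i).dist a y' ≤ 1 → a ∈ T y')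
    {mN : ℕ} (hnbr : ∀ y' : IBondY i, (T y').card ≤ mN)
    (f : SiteY i → ℝ) (y y' : IBondY i) (hs : (geo9K i).suppIn (Sum.inl f) y')
    (Λ : SiteY i → 𝔸) (hΛ : ∀ z, ‖Λ z‖ ≤ |f z|) (z : SiteY i) (hz : blkOf i.D.toDomains z = β i.hN i.D i.hk y) :
    ‖cutMulY (hTY i c) (O (KhY i par (hTY i c) V Λ)) z‖
      ≤ B₀ * (((d : ℝ) + 1) * ((1 + (mN : ℝ) * Real.exp δ) * (5 / 8 * C1F d ℓ / i.Mh)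
            + (mN : ℝ) * Real.exp δ * ((5 / 8) ^ 2 * C2F d ℓ / (i.Mh : ℝ) ^ 2))
          + ((ℓ : ℝ) + 1) ^ 4 * (sLipT d ℓ / (((ℓ : ℝ) + 1) * i.Mh)))
        * Real.exp (-(δ * (geo9K i).dist y y')) * (geo9K i).supNorm (Sum.inl f) := by
  classical
  obtain ⟨_, hMh2, _, _⟩ := side_conditions i
  have hη0 : 0 < etaS i := etaS_pos i
  have hηne : etaS i ≠ 0 := hη0.ne'
  have hL1 : (1 : ℝ) ≤ (ℓ : ℝ) + 1 := by linarith [(Nat.cast_nonneg ℓ : (0 : ℝ) ≤ ℓ)]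
  have hL0 : (0 : ℝ) < (ℓ : ℝ) + 1 := by linarith
  have hM : (0 : ℝ) < i.Mh := by exact_mod_cast (lt_of_lt_of_le (by norm_num) hMh2)
  have hE0 : 0 ≤ Real.exp (-(δ * (geo9K i).dist y y')) := (Real.exp_pos _).le
  have hF0 : 0 ≤ (geo9K i).supNorm (Sum.inl f) := geo9K_supNorm_nonneg i _
  have hC1 : 0 ≤ C1F d ℓ := C1F_nonneg d ℓ
  have hC2 : 0 ≤ C2F d ℓ := C2F_nonneg d ℓ
  have hsL : 0 ≤ sLipT d ℓ := sLipT_nonneg d ℓ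
  -- abbreviations for the three constants and the common factor
  set c₁ : ℝ := 5 / 8 * C1F d ℓ / i.Mh with hc₁
  set c₂ : ℝ := (5 / 8) ^ 2 * C2F d ℓ / (i.Mh : ℝ) ^ 2 with hc₂
  set Cs : ℝ := sLipT d ℓ / (((ℓ : ℝ) + 1) * i.Mh) with hCs
  set E : ℝ := Real.exp (-(δ * (geo9K i).dist y y')) with hE
  set S : ℝ := (geo9K i).supNorm (Sum.inl f) with hS
  have hc₁0 : 0 ≤ c₁ := by positivity
  have hc₂0 : 0 ≤ c₂ := by positivity
  have hCs0 : 0 ≤ Cs := by positivity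
  have hRHS : 0 ≤ B₀ * (((d : ℝ) + 1) * ((1 + (mN : ℝ) * Real.exp δ) * c₁ + (mN : ℝ) * Real.exp δ * c₂) + ((ℓ : ℝ) + 1) ^ 4 * Cs) * E * S := by
    positivity
  set h : SiteY i → ℝ := hTY i c with hh
  -- output localisation: the factor `h_□(z)`
  by_cases hz0 : h z = 0
  · rw [cutMulY_apply, hz0, Complex.ofReal_zero, zero_smul, norm_zero]; exact hRHS
  have hnear : levY i z ≤ c.1.1 + 1 := (mem_QT_and_lev_of_near i c (z := z) (u' := z) hz0 (torusSupNorm_sub_self_le_one i z)).2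
  have hh1 : ∀ w, |h w| ≤ 1 := fun w => abs_hT_le_one i.D (B9GeoLemma21KLevelV1.one_le_Mh i) (B9GeoLemma21KLevelV1.one_le_P i) c w
  -- the backward differences of the cut-off, their sizes, and the level bookkeeping
  obtain ⟨g, hg⟩ : ∃ g : Fin (d + 1) → SiteY i → ℝ, ∀ μ u, g μ u = h u - h ((shiftY i μ).symm u) := ⟨_, fun _ _ => rfl⟩
  set κ₁ : ℝ := C1F d ℓ / (8 / 5 * (bigSide ℓ i.Mh c.1.1 : ℝ)) with hκ₁
  set κ₂ : ℝ := C2F d ℓ / (8 / 5 * (bigSide ℓ i.Mh c.1.1 : ℝ)) ^ 2 with hκ₂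
  have hκ1 : ∀ μ w, |g μ w| ≤ κ₁ := fun μ w => by
    have hκ := abs_hTY_shiftY_sub_le i c μ ((shiftY i μ).symm w)
    rw [Equiv.apply_symm_apply] at hκ
    rw [hg]; exact hκ
  have hκ10 : 0 ≤ κ₁ := le_trans (abs_nonneg _) (hκ1 0 z)
  have hκ2 : ∀ μ w, |g μ w - g μ ((shiftY i μ).symm w)| ≤ κ₂ := fun μ w => by
    have hκ := abs_hTY_second_diff_le i c μ ((shiftY i μ).symm w)
    rw [Equiv.apply_symm_apply] at hκ
    have e : g μ w - g μ ((shiftY i μ).symm w)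
        = hTY i c w - 2 * hTY i c ((shiftY i μ).symm w) + hTY i c ((shiftY i μ).symm ((shiftY i μ).symm w)) := by
      rw [hg, hg]; ring
    rw [e]; exact hκ
  have hκ20 : 0 ≤ κ₂ := le_trans (abs_nonneg _) (hκ2 0 z)
  have hlen : (geo9K i).len y = ((ℓ : ℝ) + 1) ^ levY i z * etaS i := len_eq_pow_mul_eta i hη hz
  have hLj : (0 : ℝ) < ((ℓ : ℝ) + 1) ^ c.1.1 := pow_pos hL0 _
  have hpow : ((ℓ : ℝ) + 1) ^ levY i z ≤ ((ℓ : ℝ) + 1) ^ c.1.1 * ((ℓ : ℝ) + 1) :=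
    (pow_le_pow_right₀ hL1 hnear).trans (le_of_eq (pow_succ _ _))
  have hκpow : κ₁ * ((ℓ : ℝ) + 1) ^ levY i z ≤ c₁ := by
    rw [hκ₁, C1F_div_bigSide_eq i c.1.1]
    have hq : (((ℓ : ℝ) + 1) ^ c.1.1)⁻¹ * ((ℓ : ℝ) + 1) ^ levY i z ≤ (ℓ : ℝ) + 1 := by
      rw [inv_mul_le_iff₀ hLj]; exact hpow
    calc 5 / 8 * C1F d ℓ / (((ℓ : ℝ) + 1) * i.Mh) * (((ℓ : ℝ) + 1) ^ c.1.1)⁻¹ * ((ℓ : ℝ) + 1) ^ levY i z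
        = 5 / 8 * C1F d ℓ / (((ℓ : ℝ) + 1) * i.Mh) * ((((ℓ : ℝ) + 1) ^ c.1.1)⁻¹ * ((ℓ : ℝ) + 1) ^ levY i z) := by ring
      _ ≤ 5 / 8 * C1F d ℓ / (((ℓ : ℝ) + 1) * i.Mh) * ((ℓ : ℝ) + 1) := mul_le_mul_of_nonneg_left hq (by positivity)
      _ = c₁ := by rw [hc₁]; field_simp
  have hκ2pow : κ₂ * (((ℓ : ℝ) + 1) ^ levY i z) ^ 2 ≤ c₂ := by
    rw [hκ₂, C2F_div_bigSide_sq_eq i c.1.1]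
    have hq : ((((ℓ : ℝ) + 1) ^ c.1.1) ^ 2)⁻¹ * (((ℓ : ℝ) + 1) ^ levY i z) ^ 2 ≤ ((ℓ : ℝ) + 1) ^ 2 := by
      rw [inv_mul_le_iff₀ (pow_pos hLj 2), ← mul_pow]
      exact pow_le_pow_left₀ (by positivity) hpow 2
    calc (5 / 8) ^ 2 * C2F d ℓ / (((ℓ : ℝ) + 1) * i.Mh) ^ 2 * ((((ℓ : ℝ) + 1) ^ c.1.1) ^ 2)⁻¹ * (((ℓ : ℝ) + 1) ^ levY i z) ^ 2
        = (5 / 8) ^ 2 * C2F d ℓ / (((ℓ : ℝ) + 1) * i.Mh) ^ 2 * (((((ℓ : ℝ) + 1) ^ c.1.1) ^ 2)⁻¹ * (((ℓ : ℝ) + 1) ^ levY i z) ^ 2) := by ring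
      _ ≤ (5 / 8) ^ 2 * C2F d ℓ / (((ℓ : ℝ) + 1) * i.Mh) ^ 2 * ((ℓ : ℝ) + 1) ^ 2 := mul_le_mul_of_nonneg_left hq (by positivity)
      _ = c₂ := by rw [hc₂]; field_simp
  -- the decomposition of `K(h_□)Λ`
  obtain ⟨A, hA⟩ : ∃ A : SiteY i → 𝔸, ∀ w, A w
      = ∑ w', (((avgCoeffY i w w' * (hTY i c w - hTY i c w') : ℝ)) : ℂ) • R (avgTrY i par V w w') (Λ w') := ⟨_, fun _ => rfl⟩
  obtain ⟨C, hC⟩ : ∃ C : Fin (d + 1) → SiteY i → 𝔸, ∀ μ w, C μ w = (((g μ w - g μ ((shiftY i μ).symm w) : ℝ)) : ℂ) •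
      R (UboxY i V μ ((shiftY i μ).symm w))⁻¹ (Λ ((shiftY i μ).symm w)) := ⟨_, fun _ _ => rfl⟩
  have hKfun : KhY i par h V Λ = (∑ μ : Fin (d + 1), (cdS i V μ (cutMulY (g μ) Λ) - cutMulY (g μ) (cdsS i V μ Λ))) + A := by
    funext w
    rw [Pi.add_apply, Finset.sum_apply, hA w]
    simp only [Pi.sub_apply]
    exact KhY_apply_transposed i V par h g hg Λ w
  have hLeib : ∀ μ, cutMulY (g μ) (cdsS i V μ Λ) = cdsS i V μ (cutMulY (g μ) Λ) + C μ := fun μ => by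
    funext w; rw [Pi.add_apply, hC μ w]; exact cutMulY_cdsS_eq i V μ (g μ) Λ w
  have hOK : O (KhY i par h V Λ) z
      = (∑ μ : Fin (d + 1), (O (cdS i V μ (cutMulY (g μ) Λ)) z - (O (cdsS i V μ (cutMulY (g μ) Λ)) z + O (C μ) z))) + O A z := by
    rw [hKfun, map_add, map_sum, Pi.add_apply, Finset.sum_apply]
    congr 1
    refine Finset.sum_congr rfl fun μ _ => ?_
    rw [map_sub, hLeib μ, map_add, Pi.sub_apply, Pi.add_apply]
  -- the four pieces
  have hT1 : ∀ μ, ‖O (cdS i V μ (cutMulY (g μ) Λ)) z‖ ≤ (mN : ℝ) * Real.exp δ * B₀ * c₁ * E * S := fun μ => by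
    have h1 := norm_O_cdS_cutMul_le i V O μ hB₀ hδ ιB hι hV hκ10 (g μ) (hκ1 μ) h342₂ T hT hnbr f y y' hs Λ hΛ z hz
    rw [hlen] at h1
    have e : (mN : ℝ) * Real.exp δ * ((etaS i)⁻¹ * (B₀ * (((ℓ : ℝ) + 1) ^ levY i z * etaS i))) * E * (κ₁ * S)
        = (mN : ℝ) * Real.exp δ * B₀ * (κ₁ * ((ℓ : ℝ) + 1) ^ levY i z) * E * S := by
      field_simp
    refine (h1.trans (le_of_eq e)).trans ?_
    have h0 : 0 ≤ (mN : ℝ) * Real.exp δ * B₀ := by positivity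
    exact mul_le_mul_of_nonneg_right (mul_le_mul_of_nonneg_right (mul_le_mul_of_nonneg_left hκpow h0) hE0) hF0
  have hT2a : ∀ μ, ‖O (cdsS i V μ (cutMulY (g μ) Λ)) z‖ ≤ B₀ * c₁ * E * S := fun μ => by
    have h1 := norm_O_cdsS_cutMul_le i V O μ hB₀ hκ10 (g μ) (hκ1 μ) h342₂ f y y' hs Λ hΛ z hz
    rw [hlen] at h1
    have e : (etaS i)⁻¹ * (B₀ * (((ℓ : ℝ) + 1) ^ levY i z * etaS i) * E * (κ₁ * S)) = B₀ * (κ₁ * ((ℓ : ℝ) + 1) ^ levY i z) * E * S := by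
      field_simp
    refine (h1.trans (le_of_eq e)).trans ?_
    exact mul_le_mul_of_nonneg_right (mul_le_mul_of_nonneg_right (mul_le_mul_of_nonneg_left hκpow hB₀) hE0) hF0
  have hT2b : ∀ μ, ‖O (C μ) z‖ ≤ (mN : ℝ) * Real.exp δ * B₀ * c₂ * E * S := fun μ => by
    have h1 := norm_O_rem2_le i V O μ hB₀ hδ ιB hι hV hκ20 (g μ) (hκ2 μ) h342₀ T hT hnbr f y y' hs Λ hΛ (C μ) (hC μ) z hz
    rw [hlen] at h1
    have e : (mN : ℝ) * Real.exp δ * ((etaS i ^ 2)⁻¹ * (B₀ * (((ℓ : ℝ) + 1) ^ levY i z * etaS i) ^ 2)) * E * (κ₂ * S)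
        = (mN : ℝ) * Real.exp δ * B₀ * (κ₂ * (((ℓ : ℝ) + 1) ^ levY i z) ^ 2) * E * S := by
      field_simp
    refine (h1.trans (le_of_eq e)).trans ?_
    have h0 : 0 ≤ (mN : ℝ) * Real.exp δ * B₀ := by positivity
    exact mul_le_mul_of_nonneg_right (mul_le_mul_of_nonneg_right (mul_le_mul_of_nonneg_left hκ2pow h0) hE0) hF0
  have hT3 : ‖O A z‖ ≤ B₀ * (((ℓ : ℝ) + 1) ^ 4 * Cs) * E * S := by
    by_cases hA0 : A = 0
    · rw [hA0, map_zero, Pi.zero_apply, norm_zero]; positivity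
    have h1 := norm_O_avg_le i V O par c hB₀ hTr h342₀ f y y' hs Λ hΛ A hA z hz
    rw [hlen] at h1
    -- the window: `βy′ ∈ QT □`, so `lvl(y′) ≥ j − 1`, while `lev z ≤ j + 1`
    have hQT := beta_mem_QT_of_avg_ne_zero i V par c f y' hs Λ hΛ A hA hA0
    have hlo : c.1.1 ≤ lvl i.hN i.D i.hk y' + 1 := by
      have h := lvl_ge_of_mem_QT i c hQT
      rwa [beta_level i.hN i.D i.hk (le_trans one_le_two i.hk2)] at h
    have hlev : levY i z ≤ lvl i.hN i.D i.hk y' + 2 := by omega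
    have hLl : (0 : ℝ) < (((ℓ : ℝ) + 1) ^ lvl i.hN i.D i.hk y') ^ 2 := by positivity
    have hq : (((ℓ : ℝ) + 1) ^ levY i z) ^ 2 * ((((ℓ : ℝ) + 1) ^ lvl i.hN i.D i.hk y') ^ 2)⁻¹ ≤ ((ℓ : ℝ) + 1) ^ 4 := by
      rw [← div_eq_mul_inv, div_le_iff₀ hLl, ← pow_mul, ← pow_mul, ← pow_add]
      exact pow_le_pow_right₀ hL1 (by omega)
    have e : (etaS i ^ 2)⁻¹ * (B₀ * (((ℓ : ℝ) + 1) ^ levY i z * etaS i) ^ 2 * E *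
          (Cs * ((((ℓ : ℝ) + 1) ^ lvl i.hN i.D i.hk y') ^ 2)⁻¹ * S))
        = B₀ * ((((ℓ : ℝ) + 1) ^ levY i z) ^ 2 * ((((ℓ : ℝ) + 1) ^ lvl i.hN i.D i.hk y') ^ 2)⁻¹ * Cs) * E * S := by
      field_simp
    refine (h1.trans (le_of_eq e)).trans ?_
    exact mul_le_mul_of_nonneg_right (mul_le_mul_of_nonneg_right
      (mul_le_mul_of_nonneg_left (mul_le_mul_of_nonneg_right hq hCs0) hB₀) hE0) hF0
  -- assemble
  have hsumμ : ∀ μ : Fin (d + 1), ‖O (cdS i V μ (cutMulY (g μ) Λ)) z - (O (cdsS i V μ (cutMulY (g μ) Λ)) z + O (C μ) z)‖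
      ≤ B₀ * ((1 + (mN : ℝ) * Real.exp δ) * c₁ + (mN : ℝ) * Real.exp δ * c₂) * E * S := fun μ => by
    refine (norm_sub_le _ _).trans ((add_le_add (hT1 μ) ((norm_add_le _ _).trans (add_le_add (hT2a μ) (hT2b μ)))).trans (le_of_eq ?_))
    ring
  rw [cutMulY_apply, norm_ofReal_smul, hOK]
  calc |h z| * ‖(∑ μ : Fin (d + 1), (O (cdS i V μ (cutMulY (g μ) Λ)) z - (O (cdsS i V μ (cutMulY (g μ) Λ)) z + O (C μ) z))) + O A z‖
      ≤ 1 * (‖∑ μ : Fin (d + 1), (O (cdS i V μ (cutMulY (g μ) Λ)) z - (O (cdsS i V μ (cutMulY (g μ) Λ)) z + O (C μ) z))‖ + ‖O A z‖) :=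
        mul_le_mul (hh1 z) (norm_add_le _ _) (norm_nonneg _) zero_le_one
    _ ≤ (∑ μ : Fin (d + 1), B₀ * ((1 + (mN : ℝ) * Real.exp δ) * c₁ + (mN : ℝ) * Real.exp δ * c₂) * E * S)
          + B₀ * (((ℓ : ℝ) + 1) ^ 4 * Cs) * E * S := by
        rw [one_mul]
        exact add_le_add ((norm_sum_le _ _).trans (Finset.sum_le_sum fun μ _ => hsumμ μ)) hT3
    _ = _ := by
        rw [Finset.sum_const, Finset.card_univ, Fintype.card_fin, nsmul_eq_mul]
        push_cast
        ring

end Main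

end Literature.MathematicalPhysics.QuantumFieldTheory.Balaban1983to89.B9Thm37TransposedCommutator

end
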